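import Literature.AnabelianGeometry.EtaleTheta.SettingModelChiTwistedLatticeEmbedding
import HarnessLib

/-!
# The χ-twisted root model with an extra Tate lattice, file 1f: the theta / ell kernels of `curveLat` ARE the images of
# those of `curveχ` under the slice embedding (input of file 2's coefficient isomorphism `Δ_Θ(curveχ) ≅ Δ_Θ(curveLat)`)

Mochizuki, *The étale theta function …*, Publ. RIMS **45** (2009) [EtTh], §1, PRIMS PDF p. 12 ("the quotients
`Δ_X ↠ Δ^Θ_X ↠ Δ^ell_X`", `Δ^Θ_X = Δ_X/[Δ_X,[Δ_X,Δ_X]]`) [cite: MochizukiEtTh2009, §1 p.12].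

LATTICE TWIST OF `Ẑ(1)²` — NOT the (B) section twist (cf. file 1, `SettingModelChiTwistedLattice.lean`, and abc-iut-L2-lead
R709).  abc-iut cell, K-L6 slice, row «KL6-CLOSURE-CERT F-2633», seat abc-iut-L6-t19 (gen 8).  PROOF-ONLY over files 1–1e:

* `commutator_deltaHatLat_le_map` / `commutator₃_deltaHatLat_le_map`: `[Δ_X□, Δ_X□] ≤ ι̂([Δ_Xχ, Δ_Xχ])` and
  `[[Δ_X□, Δ_X□], Δ_X□] ≤ ι̂([[Δ_Xχ, Δ_Xχ], Δ_Xχ])` — commutators kill the (abelian, Galois-trivial on `Δ`) lattice coordinate, and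
  `Δ_Xχ = Ker(Π_Xχ ↠ G_{ℚ_p})` (abc-iut-w5-d249's `deltaHatχ_eq`);
* `closure_le_map_closure_iotaPiHat`: `ι̂` is a closed map (compact source, Hausdorff target), so closures follow;
* **`iotaPi_mem_thetaKer_iff`**, **`iotaPi_mem_ellKer_iff`**: `ι g ∈ Ker(Π^tp_X□ ↠ (·)^Θ) ↔ g ∈ Ker(Π^tp_Xχ ↠ (·)^Θ)` and the same
  for `(·)^ell` — together with file 1c's `left_snd_eq_one_of_mem_thetaKer` (both kernels of `curveLat` have lattice coordinate
  `1`, i.e. lie in the image of `ι`) this identifies `Δ_Θ(curveLat) = Ker(θ→ell)` with `ι(Δ_Θ(curveχ))` set-theoretically.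

HONEST LABEL: semi-synthetic model bookkeeping; nothing of [EtTh] asserted; no side taken on [IUTchIII] Cor. 3.12.  PROOF-ONLY
(no `def`, no instance, no notation).
-/

noncomputable section

namespace Literature.AnabelianGeometry.EtaleTheta.SettingModel

open Literature.AnabelianGeometry.SemiGraphs _root_.Topology _root_.Function
open scoped commutatorElement

variable (p : ℕ) [Fact p.Prime]

/-- An element of `Π_X□` with trivial Galois coordinate is `inl` of its left coordinate. [cite: MochizukiEtTh2009, §1 p.12] -/
theorem eq_inl_left_of_right_eq_one {a : PiHtLat p} (ha : a.right = 1) : a = SemidirectProduct.inl a.left := by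
  rw [← SemidirectProduct.inl_left_mul_inr_right a, ha, map_one, mul_one, SemidirectProduct.left_inl]

/-- The commutator of two elements of `Π_X□` with trivial Galois coordinate is the `ι̂`-image of the commutator of their
`F̂₂`-coordinates (the lattice `Ẑ(1)²` is abelian). [cite: MochizukiEtTh2009, §1 p.12] -/
theorem commutatorElement_eq_iotaPiHat {a b : PiHtLat p} (ha : a.right = 1) (hb : b.right = 1) :
    ⁅a, b⁆ = iotaPiHat p ⁅(SemidirectProduct.inl a.left.1 : PiHtχ p), SemidirectProduct.inl b.left.1⁆ := by
  rw [← map_commutatorElement]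
  conv_lhs => rw [eq_inl_left_of_right_eq_one p ha, eq_inl_left_of_right_eq_one p hb]
  rw [← map_commutatorElement]
  apply SemidirectProduct.ext
  · rw [SemidirectProduct.left_inl, iotaPiHat_left, SemidirectProduct.left_inl]
    refine Prod.ext rfl ?_
    show ⁅a.left, b.left⁆.2 = 1
    rw [commutatorElement_def]
    show a.left.2 * b.left.2 * a.left.2⁻¹ * b.left.2⁻¹ = 1
    have hc : a.left.2 * b.left.2 = b.left.2 * a.left.2 :=
      Prod.ext (Literature.AnabelianGeometry.AbsoluteAnabelian.ZHatCompletion.mul_comm _ _)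
        (Literature.AnabelianGeometry.AbsoluteAnabelian.ZHatCompletion.mul_comm _ _)
    rw [hc, mul_inv_cancel_right, mul_inv_cancel]
  · rw [SemidirectProduct.right_inl, iotaPiHat_right, SemidirectProduct.right_inl]

/-- **`[Δ_X□, Δ_X□] ≤ ι̂([Δ_Xχ, Δ_Xχ])`.** [cite: MochizukiEtTh2009, §1 p.12] -/
theorem commutator_deltaHatLat_le_map :
    ⁅(curveLat p).DeltaHat, (curveLat p).DeltaHat⁆ ≤
      (⁅(curveχ p).DeltaHat, (curveχ p).DeltaHat⁆).map (iotaPiHat p).toMonoidHom := by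
  have hR := deltaHatLat_le_ker_rightHom p
  rw [Subgroup.commutator_le]
  intro a ha b hb
  rw [commutatorElement_eq_iotaPiHat p (hR ha) (hR hb)]
  exact ⟨_, Subgroup.commutator_mem_commutator (inl_mem_deltaHatχ p _) (inl_mem_deltaHatχ p _), rfl⟩

/-- **`[[Δ_X□, Δ_X□], Δ_X□] ≤ ι̂([[Δ_Xχ, Δ_Xχ], Δ_Xχ])`.** [cite: MochizukiEtTh2009, §1 p.12] -/
theorem commutator₃_deltaHatLat_le_map :
    ⁅⁅(curveLat p).DeltaHat, (curveLat p).DeltaHat⁆, (curveLat p).DeltaHat⁆ ≤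
      (⁅⁅(curveχ p).DeltaHat, (curveχ p).DeltaHat⁆, (curveχ p).DeltaHat⁆).map (iotaPiHat p).toMonoidHom := by
  have hR := deltaHatLat_le_ker_rightHom p
  have h2 := commutator_deltaHatLat_le_map p
  haveI := deltaHatχ_normal p
  rw [Subgroup.commutator_le]
  intro c hc d hd
  obtain ⟨c₀, hc₀, hc₀e⟩ := h2 hc
  -- `c₀ ∈ [Δ_Xχ, Δ_Xχ] ≤ Δ_Xχ = Ker(right)`, so `c₀ = inl c₀.left` and `c = ι̂ c₀` has `c.left.1 = c₀.left`
  have hc₀Δ : c₀ ∈ (curveχ p).DeltaHat :=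
    (Subgroup.commutator_le_left _ _) hc₀
  have hc₀r : c₀.right = 1 := right_eq_one_of_mem_deltaHatχ p hc₀Δ
  have hcr : c.right = 1 := by
    rw [← hc₀e]
    exact hc₀r
  have hce : c.left.1 = c₀.left := by
    rw [← hc₀e]
    rfl
  have hc₀inl : (SemidirectProduct.inl c.left.1 : PiHtχ p) = c₀ := by
    rw [hce, ← SemidirectProduct.inl_left_mul_inr_right c₀, hc₀r, map_one, mul_one, SemidirectProduct.left_inl]
  rw [commutatorElement_eq_iotaPiHat p hcr (hR hd), hc₀inl]
  exact ⟨_, Subgroup.commutator_mem_commutator hc₀ (inl_mem_deltaHatχ p _), rfl⟩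

/-- `ι̂` maps closures onto closures of images: it is a CLOSED map (compact source, Hausdorff target), so
`closure(K□) ≤ ι̂(closure Kχ)` whenever `K□ ≤ ι̂(Kχ)`. [cite: MochizukiEtTh2009, §1 p.12] -/
theorem closure_le_map_closure_iotaPiHat {K : Subgroup (PiHtχ p)} {L : Subgroup (PiHtLat p)}
    (h : L ≤ K.map (iotaPiHat p).toMonoidHom) :
    L.topologicalClosure ≤ (K.topologicalClosure).map (iotaPiHat p).toMonoidHom := by
  refine Subgroup.topologicalClosure_minimal _ (h.trans (Subgroup.map_mono K.le_topologicalClosure)) ?_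
  show IsClosed ((iotaPiHat p) '' ((K.topologicalClosure : Subgroup (PiHtχ p)) : Set (PiHtχ p)))
  exact (K.isClosed_topologicalClosure.isCompact.image (iotaPiHat p).continuous).isClosed

/-- `ι̂` is injective. [cite: MochizukiEtTh2009, §1 p.12] -/
theorem iotaPiHat_injective : Injective (iotaPiHat p) :=
  Semidirect.mapCont_injective _ _ _ _ fun a b h => by simpa using congrArg Prod.fst h

/-- **`ι g ∈ Ker(Π^tp_X□ ↠ (Π^tp_X□)^Θ) ↔ g ∈ Ker(Π^tp_Xχ ↠ (Π^tp_Xχ)^Θ)`.** [cite: MochizukiEtTh2009, §1 p.12] -/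
theorem iotaPi_mem_thetaKer_iff (g : PiTpχ p) :
    iotaPi p g ∈ CurveTheta.thetaKer (curveLat p) ↔ g ∈ CurveTheta.thetaKer (curveχ p) := by
  refine ⟨fun hg => ?_, iotaPi_mem_thetaKer p⟩
  have hmem : toHatLat p (iotaPi p g) ∈
      (⁅⁅(curveLat p).DeltaHat, (curveLat p).DeltaHat⁆, (curveLat p).DeltaHat⁆).topologicalClosure := hg
  rw [toHatLat_iotaPi] at hmem
  obtain ⟨h, hh, hhe⟩ := closure_le_map_closure_iotaPiHat p (commutator₃_deltaHatLat_le_map p) hmem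
  have he : h = toHatχ p g := iotaPiHat_injective p hhe
  show toHatχ p g ∈ (⁅⁅(curveχ p).DeltaHat, (curveχ p).DeltaHat⁆, (curveχ p).DeltaHat⁆).topologicalClosure
  rw [← he]
  exact hh

/-- **`ι g ∈ Ker(Π^tp_X□ ↠ (Π^tp_X□)^ell) ↔ g ∈ Ker(Π^tp_Xχ ↠ (Π^tp_Xχ)^ell)`.** [cite: MochizukiEtTh2009, §1 p.12] -/
theorem iotaPi_mem_ellKer_iff (g : PiTpχ p) :
    iotaPi p g ∈ CurveTheta.ellKer (curveLat p) ↔ g ∈ CurveTheta.ellKer (curveχ p) := by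
  refine ⟨fun hg => ?_, iotaPi_mem_ellKer p⟩
  have hmem : toHatLat p (iotaPi p g) ∈ (⁅(curveLat p).DeltaHat, (curveLat p).DeltaHat⁆).topologicalClosure := hg
  rw [toHatLat_iotaPi] at hmem
  obtain ⟨h, hh, hhe⟩ := closure_le_map_closure_iotaPiHat p (commutator_deltaHatLat_le_map p) hmem
  have he : h = toHatχ p g := iotaPiHat_injective p hhe
  show toHatχ p g ∈ (⁅(curveχ p).DeltaHat, (curveχ p).DeltaHat⁆).topologicalClosure
  rw [← he]
  exact hh

/-- Every element of the theta kernel of `curveLat` is in the image of `ι` (its lattice and Galois coordinates are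
trivial). [cite: MochizukiEtTh2009, §1 p.12] -/
theorem exists_iotaPi_eq_of_mem_ellKer {g : PiTpLat p} (hg : g ∈ CurveTheta.ellKer (curveLat p)) :
    ∃ g₀ : PiTpχ p, iotaPi p g₀ = g := by
  have hT : g.left.2 = 1 := by
    -- `ellKer ≤ thetaKer`? No: `thetaKer ≤ ellKer`; argue directly through `[Δ_X□, Δ_X□] ≤ ι̂(…) ≤ range inlHatF`-type facts:
    have hmem : toHatLat p g ∈ (⁅(curveLat p).DeltaHat, (curveLat p).DeltaHat⁆).topologicalClosure := hg
    obtain ⟨h, -, hhe⟩ := closure_le_map_closure_iotaPiHat p (commutator_deltaHatLat_le_map p) hmem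
    have e := congrArg (fun x : PiHtLat p => x.left.2) hhe
    simp only [toHatLat_left, gfpLatFst_apply] at e
    exact e.symm
  refine ⟨⟨g.left.1, g.right⟩, SemidirectProduct.ext ?_ rfl⟩
  rw [iotaPi_left]
  exact Prod.ext rfl hT.symm

end Literature.AnabelianGeometry.EtaleTheta.SettingModel

end
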